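import Literature.AnabelianGeometry.EtaleTheta.TemperedFrobenioidOfGaloisCoveringTateTower
import Literature.AnabelianGeometry.EtaleTheta.TemperedFrobenioidOfRankOneObject
import Literature.AnabelianGeometry.EtaleTheta.BiKummerThm44SubModelConnectedOfGaloisCoveringCoset

/-!
# [EtTh] Def 3.6 (ii) at the MODEL OF RECORD: a tempered Frobenioid over the COSET-model constructed Def 3.3 (iii) data of
# abc-iut-w6-d058's TATE TOWER (`G = Gal(Z_∞/X) = ℤ`, non-trivial action) — non-vacuity of the coset-model theorem families
# at a non-degenerate datum (class (b) instance)

S. Mochizuki, *The étale theta function …*, Publ. RIMS **45** (2009) [MochizukiEtTh2009], Def. 3.3 (iii) PDF p.73, Def. 3.6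
(i)(ii) pp.76–77 [cite: MochizukiEtTh2009, Def 3.6 p.77]; S. Mochizuki, *The geometry of Frobenioids II* (2008), Ex. 1.1
[cite: MochizukiFrdII2008, Ex. 1.1 p.408].

abc-iut cell, layer L2; seat abc-iut-w5-d179 (gen 5), SUBDAG-EtTh-Thm44 custodian lineage.  CLASS (b) INSTANCE (one `def` of
the record `DivisorMonoids.RankOneObject`; 0 instances / notation / `Prop` facts; flagged to ref-d).  Consumed BY NAME:
abc-iut-w6-d058's `TateTower.model / .action / .cuspLaws` (`LogDivisorModelTateTower.lean`, p444705 — the cell's non-degenerate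
Def 3.1 / 3.3 (iii) model of record, L2-lead R311), abc-iut-w6-d048's rank-one data at the one-point covering `G/G`
(`TateTowerFrd.phiZeroTopEquivNat`, `cnstFn`, `cnstFn_mem_fZero`, `div₀_cnstFn`, `eq_constPhi_multAt`; p446077), this lineage's
coset model `DivisorMonoids.ofGaloisActionCoset` (p442175) and `dm`-generic engine `TemperedFrobenioid.ofRankOneObject`
(p446238).

WHAT THIS FILE PROVES.  The coset object `⊤ : Subgroup ℤ` (the covering `G/G = X` itself) is a RANK-ONE OBJECT of the coset
data `DivisorMonoids.ofGaloisActionCoset TateTower.action TateTower.cuspLaws` (`TateTowerCoset.rankOneObject`: its `G`-set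
`cosetGSet ℤ ⊤ = ℤ/ℤ` is abc-iut-w6-d048's one-point covering `top` on the nose, so their `Φ₀(G/G) ≅ ℕ` and «every log-divisor
over `G/G` is `div₀(ϖᶜ)`» transfer verbatim); hence `TateTowerCoset.temperedFrobenioid` — a tempered Frobenioid (weak data of
record, monoid type `ℤ`) over `ofRlfZWeak (DivisorMonoids.ofGaloisActionCoset TateTower.action TateTower.cuspLaws) hpf` — and
`nonempty_temperedFrobenioid_ofGaloisActionCoset_tateTower[_connectedPart]`: the coset-model theorem families (p443031 / p443606
/ p444666 / p446933) are NON-VACUOUS AT THE MODEL OF RECORD (over `Discrete PUnit` and over `B^temp(Π)⁰` for every `Π`), with the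
lineage's hypothesis-free «`C` is a Frobenioid» instantiated there (`isFrobenioid_temperedFrobenioid_byName`).
HONEST LABEL: `D` one object over the one-point covering; a consistency / instantiation witness, not the tempered Frobenioid of
the whole tower; `BiKummerSetting` / `Thm44Hyp` NOT claimed inhabited.  Nothing here bears on [IUTchIII] Cor. 3.12; no side taken.
-/

noncomputable section

namespace Literature.AnabelianGeometry.EtaleTheta

open CategoryTheory Opposite Function Literature.AlgebraicGeometry.Frobenioids
  Literature.AnabelianGeometry.SemiGraphs LogDivisorModel LogDivisorModel.GaloisAction

namespace TateTowerCoset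

/-- The coset-model Def. 3.3 (iii) data of the Tate tower (`G = ℤ`; objects `Subgroup ℤ`, `D₀ : Type 0`).
[cite: MochizukiEtTh2009, Def 3.3 p.73] -/
abbrev dm : DivisorMonoids.{0, 0, 0} (InducedCategory (Action (Type 0) (Multiplicative ℤ)) (cosetGSet (Multiplicative ℤ))) :=
  DivisorMonoids.ofGaloisActionCoset TateTower.action TateTower.cuspLaws

/-- Prop. 3.4 (i) (weak, cofinal perfection) for every `Φ₀(G/H)` of the Tate tower's coset data (the `hpf` slot, proved).
[cite: MochizukiEtTh2009, Prop 3.4 p.74] -/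
abbrev hpf : ∀ Y : (InducedCategory (Action (Type 0) (Multiplicative ℤ)) (cosetGSet (Multiplicative ℤ)))ᵒᵖ,
    IsPerfFactorialCof (dm.Φ₀.obj Y) :=
  DivisorMonoids.ofGaloisActionCoset_isPerfFactorialCof TateTower.action TateTower.cuspLaws

/-- **The covering `G/G` (= the Tate curve `X` itself) is a rank-one object of the coset data**: `Φ₀(G/G) ≅ ℕ`
(translation-invariant effective log-divisors are constant along the chain) and every log-divisor over it is `div₀(ϖᶜ)` —
abc-iut-w6-d048's `TateTowerFrd.rankOnePoint` data, read at the coset object `⊤` (same `G`-set `ℤ/ℤ` on the nose).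
[cite: MochizukiEtTh2009, Def 3.3 p.73] -/
def rankOneObject : dm.RankOneObject where
  Y₀ := (⊤ : Subgroup (Multiplicative ℤ))
  e := TateTowerFrd.phiZeroTopEquivNat
  hcnst m := ⟨TateTowerFrd.cnstFn (TateTowerFrd.multAt m), TateTowerFrd.cnstFn_mem_fZero _,
    (TateTowerFrd.div₀_cnstFn (TateTowerFrd.multAt m)).trans
      (congrArg Algebra.GrothendieckGroup.of (TateTowerFrd.eq_constPhi_multAt m)).symm⟩

variable (R S : ((Discrete PUnit.{1})ᵒᵖ ⥤ CommMonCat.{0}) → Prop)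

/-- **A tempered Frobenioid over the COSET-model constructed data of the Tate tower** (weak data of record, monoid type
`ℤ`; base `pt ↦ G/G`): the `p`-adic Frobenioid of the base field of the Tate curve, via the `dm`-generic rank-one engine.
[cite: MochizukiEtTh2009, Def 3.6 p.77] -/
def temperedFrobenioid :
    TemperedFrobenioid (RealifiedDivisorMonoids.ofRlfZWeak dm hpf) (Discrete PUnit.{1}) (treeCatVocab (Discrete PUnit.{1}) R S) :=
  TemperedFrobenioid.ofRankOneObject rankOneObject hpf R S

/-- **NON-VACUITY of the coset-model theorem families AT THE MODEL OF RECORD**: `TemperedFrobenioid (ofRlfZWeak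
(DivisorMonoids.ofGaloisActionCoset TateTower.action TateTower.cuspLaws) _) _ _` is inhabited.
[cite: MochizukiEtTh2009, Def 3.6 p.77] -/
theorem nonempty_temperedFrobenioid_ofGaloisActionCoset_tateTower :
    Nonempty (TemperedFrobenioid
      (RealifiedDivisorMonoids.ofRlfZWeak (DivisorMonoids.ofGaloisActionCoset TateTower.action TateTower.cuspLaws)
        (DivisorMonoids.ofGaloisActionCoset_isPerfFactorialCof TateTower.action TateTower.cuspLaws))
      (Discrete PUnit.{1}) (treeCatVocab (Discrete PUnit.{1}) R S)) :=
  ⟨temperedFrobenioid R S⟩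

/-- **«`C` is a Frobenioid» INSTANTIATED at the model of record, coset data** ([FrdI] Thm. 5.2 (ii) via the engine's
`isFrobenioid_ofRankOneObject`). [cite: MochizukiFrdI2008, Thm. 5.2 (ii) p.100] -/
theorem isFrobenioid_temperedFrobenioid : PreFrobenioid.IsFrobenioid (temperedFrobenioid R S).toElem :=
  TemperedFrobenioid.isFrobenioid_ofRankOneObject rankOneObject hpf R S

variable (Γ : Type) [Group Γ] [TopologicalSpace Γ] (R' S' : ((ConnectedPart (BTemp Γ))ᵒᵖ ⥤ CommMonCat.{0}) → Prop)

/-- **… and over print's GENUINE base `B^temp(Π)⁰` for EVERY topological group `Π`** (the `mkOfConnectedTemperoid`-based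
Thm 4.4 files' `tf_i` at the coset data of the model of record). [cite: MochizukiEtTh2009, Def 3.6 p.77] -/
theorem nonempty_temperedFrobenioid_ofGaloisActionCoset_tateTower_connectedPart :
    Nonempty (TemperedFrobenioid
      (RealifiedDivisorMonoids.ofRlfZWeak (DivisorMonoids.ofGaloisActionCoset TateTower.action TateTower.cuspLaws)
        (DivisorMonoids.ofGaloisActionCoset_isPerfFactorialCof TateTower.action TateTower.cuspLaws))
      (ConnectedPart (BTemp Γ)) (treeCatVocab (ConnectedPart (BTemp Γ)) R' S')) :=
  ⟨TemperedFrobenioid.ofRankOneObjectConnectedPart rankOneObject hpf (fun _ => True) (fun _ => True) Γ R' S'⟩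

/-- **This lineage's hypothesis-free «`C` is a Frobenioid» theorem for tempered Frobenioids over the coset data
(`BiKummerSetting.isFrobenioid_ofGaloisActionCoset_treeVocabWeak`'s ConnectedPart form, p440294 / p443031 family)
INSTANTIATED at an ACTUAL tempered Frobenioid over the model of record** — the re-based witness over `B^temp(Π)⁰`.
[cite: MochizukiEtTh2009, Def 3.6 p.77] -/
theorem isFrobenioid_temperedFrobenioid_connectedPart_byName :
    PreFrobenioid.IsFrobenioid
      (TemperedFrobenioid.ofRankOneObjectConnectedPart rankOneObject hpf (fun _ => True) (fun _ => True) Γ R' S').toElem :=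
  (TemperedFrobenioid.ofRankOneObjectConnectedPart rankOneObject hpf (fun _ => True) (fun _ => True) Γ R' S')
    |>.isFrobenioid_connectedPart_bTemp
      (DivisorMonoids.ofGaloisActionCoset_ofRlfZWeak_hBinj TateTower.action TateTower.cuspLaws hpf)

end TateTowerCoset

end Literature.AnabelianGeometry.EtaleTheta

end
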